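import Literature.AlgebraicGeometry.Milne1999.SpecialLefschetzGroupInvariantsSpMultiplicity
import Literature.AlgebraicGeometry.Milne1999.SpecialLefschetzGroupInvariantsRealMultiplicationPowers
import Literature.AlgebraicGeometry.Milne1999.SpecialLefschetzGroupInvariantsSymplectic
import HarnessLib

/-!
# Milne 1999, Cor. 4.5 / Thm. 3.2 / Prop. 3.6 (a) with multiplicity: the `S`-invariants of ALL POWERS of a
# complex abelian variety with `C(A) ⊗ ℂ = End(H¹(A))` are Lefschetz classes

Family `hodge`, layer `Literature/AlgebraicGeometry/Milne1999`, namespace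
`Literature.AlgebraicGeometry.Milne1999` (D-0022). THEOREMS ONLY (no definition, no named fact, no `sorry`;
D-0026, net debt 0). Written for the cell `pub-hodgecm2` (COR-CM), seat `lit-milne`, binder table
`HOME/lit/milne.md` rows M2/M4 (the record `Milne1999_specialLefschetzGroup_invariants_le` of
`Milne1999/LefschetzGroup`: Cor. 4.5 with Thm. 4.4 and Thm. 3.2, whose CONCLUSION is proved here on a new
locus; its wording is untouched). Sequel of `Milne1999/SpecialLefschetzGroupInvariantsSymplectic` (the same
abelian varieties, `r = 1`, by weights), of `Milne1999/SpecialLefschetzGroupInvariantsSpMultiplicity` (the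
abstract criterion: Prop. 3.6 (a) WITH MULTIPLICITY for one symplectic block, through the first fundamental
theorem for `Sp` on tensors, `RepresentationTheory/ClassicalInvariants/SymplecticTensorFFT`) and of
`Milne1999/SpecialLefschetzGroupInvariantsRealMultiplicationPowers` (the same architecture for symplectic
PLANES). The first locus of the record with a symplectic block `Sp_{2g}` of arbitrary rank and arbitrary
multiplicity `r = N + 1`: all powers of the generic abelian variety (`End(A) = ℤ`), the case that the
`r = 1` file's "NOT here" and `…RealMultiplicationPowers`' "NOT here" ("symplectic blocks of rank `≥ 4`")
left open.

## Source, verbatim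

J. S. Milne, *Lefschetz classes on abelian varieties*, Duke Math. J. 96 (1999) 639–675
[`paper:doi-10-1215-s0012-7094-99-09620-5`, held; PDF page = printed page − 638]:

* §1 p. 643 (p0005 L12–L13): "For any positive integer `r`, `V(A^r) = rV(A)`, and the diagonal action of
  `C(A)` on `rV(A)` identifies `C(A)` with `C(A^r)` (as `k`-algebras with involution)."  p. 644: "for any
  ample divisor `D` on `A`, `S(A)` is the largest algebraic subgroup of `Sp(e_D)` whose elements commute with
  the endomorphisms of `A`"; "`S(A)` depends only on the isogeny class of `A`".
* p. 654 (p0016 L37–41): "The symplectic group. Let `φ` be a nondegenerate skew-symmetric bilinear form on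
  `V`, and let `G = Sp(φ)`. Note that `φ` can be identified with an element of `H ⊗ H`. For odd `m`,
  `(H^{⊗m})^G = 0`, and for even `m`, `(H^{⊗m})^G` is generated as a `k[S_m]`-algebra by `φ ⊗ φ ⊗ ⋯ ⊗ φ`
  (`m/2` copies) (Fulton and Harris 1991, F.13)."
* Prop. 3.6 (p. 655, p0017 L10–15): "With the above notations, `(⋀^*(rH))^G = k[(⊗² rH)^G]` all `r ≥ 1`,
  in each of the following cases: (a) `G = Sp(φ)` with `φ` a nondegenerate skew-symmetric form on `V`; […]";
  Prop. 3.3 (p. 653), Prop. 3.4, Remark 3.7 and p. 656; Cor. 4.5 and p. 659: "`H^{2*}(A^r)(*)^{L(A)} =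
  D_hom(A^r)_k` […] the kernel of `l(A)` […] equals `S(A)`"; Cor. 4.7.

## What is proved (complex `A` with `centralizerAlgebra A = ⊤`, Betti cohomology, the tree's carriers)

For such `A` every endomorphism acts on `H¹(A(ℂ); ℂ)` by a scalar (`centralizerAlgebra_eq_top_iff`), so
`S(A)(ℂ) = Sp(H¹(A), Q_h)` (`mem_unitaryCentralizerGroup_iff_of_centralizerAlgebra_eq_top`) and `S(A^{N+1})(ℂ)`
contains the diagonal images `u^{⊕(N+1)}` (`LefschetzCentraliserPowers.diagPow`) of all of `Sp(H¹(A), Q_h)`.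

* §1 coordinates: `B(u bᵢ, u bⱼ) = (MᵀΩM)ᵢⱼ`, `MᵀΩM = Ω` for a form-preserving `u`, hence `MΩ⁻¹Mᵀ = Ω⁻¹`,
  and the change of variables in a `2`-tensor (`sum_sum_smul_bilin_eq`, Goodman–Wallach (5.34)).
* §2 `sum_smul_cross_mem_span_rational_oneOne` — the weighted crossed classes
  `∑ Θ_{ac} g^*e_a ⌣ g'^*e_c = ½((g+g')^*θ − g^*θ − g'^*θ)` of a divisor class `θ = ∑ Θ_{ac} e_a ⌣ e_c` are
  divisor classes (Prop. 3.3 on `A × A`).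
* §3 **`mem_divisorClassesSpan_powSucc_of_forall_exteriorPullback_eq_of_centralizerAlgebra_eq_top`** — the
  `S(ℂ)`-form: every class of `H^{2p}(A^{N+1}(ℂ); ℂ)` fixed by `⋀^{2p}u` for all
  `u ∈ S(A^{N+1})(ℂ) = unitaryCentralizerGroup (A.powSucc N) (Σᵢ prᵢ^* h)` lies in `Dᵖ(A^{N+1}) ⊗ ℂ`. Proof:
  the one-block criterion of `…SpMultiplicity` on the letters `prⱼ^* b_ℓ` (`b` any basis of `H¹(A)`, `Ω` the
  Gram matrix of the scalar symplectic form `λ ∘ Q_h`, `exists_bilinForm_isAlt_nondegenerate`); for `g` with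
  `gᵀΩg = Ω` the automorphism of `H¹(A)` with matrix `g` preserves `Q_h`, so lies in `S(A)(ℂ)`, and its
  diagonal image acts on every slot by `g`; the crossed classes `∑ (Ω⁻¹)_{ac} prⱼ^* b_a ⌣ pr_{j'}^* b_c` are
  divisor classes by §2, because `θ = ∑ (Ω⁻¹)_{ac} b_a ⌣ b_c` — the form `φ ∈ H ⊗ H` — is fixed by every
  `u ∈ S(A)(ℂ)` (§1) and the `S(A)(ℂ)`-invariants of `H²` are Hodge classes (Prop. 3.3 in the tree's
  `S(ℂ)`-form `mem_hodgeClassSpan_of_forall_exteriorPullback_eq`).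
* **`exists_polarization_invariants_le_powSucc_of_centralizerAlgebra_eq_top`** — the polarization package of
  `A^{N+1}` (`SpecialLefschetzGroupOneEqUnitaryCentralizer` §Powers), consumed by
  `SpecialLefschetzGroupInvariantsFiniteProducts`.
* **`specialLefschetzGroup_invariants_le_powSucc_of_centralizerAlgebra_eq_top`** — the CONCLUSION of the
  record for every power `A^{N+1}` (no hypothesis beyond `centralizerAlgebra A = ⊤`: the polarization class is
  the rational Kähler class of a projective embedding, `nonempty_kaehlerRationalDatum`);
  `…_of_forall_pullbackOne_eq_algebraMap` (hypothesis "every `φ^*` is a scalar", e.g. `End(A) = ℤ`);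
  `…_of_isIsogenous_powSucc_…` (Cor. 4.7 / Prop. 1.5); Cor. 4.5 as an equality of sets; Prop. 4.8 (c) ⇒ (a)
  on `A^{N+1}`, hypotheses closed.

NOT here: several symplectic blocks `∏_σ Sp(V_σ)` (type I with `[F:ℚ] > 1` and rank `≥ 4`, types II/III):
needs the coloured tensor FFT for `Sp`; orthogonal and general-linear blocks mixed with symplectic ones; the
record itself is NOT discharged.

## References

* [Milne1999LefschetzClasses] J. S. Milne, Lefschetz classes on abelian varieties, Duke Math. J. 96 (1999)
  639–675: §1 pp. 643–644 and Prop. 1.5, p. 654 "The symplectic group", Props. 3.3–3.4, 3.6 (a),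
  Remark 3.7 (pp. 653–656), Thm. 4.4, Cor. 4.5, Cor. 4.7 (p. 659), Prop. 4.8 (p. 660).
* [GoodmanWallachGTM255] R. Goodman, N. R. Wallach, GTM 255 (2009), Thm. 5.3.3 (2), Thm. 5.3.5, (5.34).
* [LangeBirkenhake1992] H. Lange, Ch. Birkenhake, Complex Abelian Varieties (1992), Lemma 1.1.17, §5.3.
* [HatcherAT2002] A. Hatcher, Algebraic Topology (2002), §3.2 Prop. 3.10.
-/

noncomputable section

open scoped BigOperators Matrix
open CategoryTheory
open Literature.AlgebraicTopology.SingularHomology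
open Literature.AlgebraicGeometry.HodgeTheory
open Literature.AlgebraicGeometry.Motives
open Literature.AlgebraicGeometry.VanGeemen1994 (pullbackOne hodgeClassSpan)
open Literature.Barriers.HodgeConjecture (divisorClassesSpan divisorMonomials mem_divisorMonomials_zero)
open Literature.Geometry.Kaehler (lefschetzPow)
open Literature.RepresentationTheory.ClassicalInvariants

namespace Literature.AlgebraicGeometry.Milne1999

/-! ### §1 Linear algebra of a form-preserving automorphism in coordinates -/

section Matrices

variable {V W : Type*} [AddCommGroup V] [Module ℂ V] [AddCommGroup W] [Module ℂ W] {n : ℕ}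

/-- **`B(u bᵢ, u bⱼ) = (Mᵀ Ω M)ᵢⱼ`** for a bilinear form with Gram matrix `Ω = (B(bₐ, b_c))` and a linear map
with `u bᵢ = ∑ₐ M_{a i} bₐ` (the polarization form in coordinates, Milne §1: "`S(A) ⊆ Sp(e_D)`").
[cite: Milne1999LefschetzClasses, §1 p. 644] [cite: LangeBirkenhake1992, Lemma 1.1.17] -/
theorem bilin_apply_eq_transpose_mul_mul (B : LinearMap.BilinForm ℂ V) (b : Module.Basis (Fin n) ℂ V)
    {u : V → V} {M : Matrix (Fin n) (Fin n) ℂ} (hu : ∀ i, u (b i) = ∑ a, M a i • b a) (i j : Fin n) :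
    B (u (b i)) (u (b j)) = (Mᵀ * LinearMap.BilinForm.toMatrix b B * M) i j := by
  calc B (u (b i)) (u (b j)) = ∑ a, ∑ c, M a i * M c j * B (b a) (b c) := by
        rw [hu, hu, LinearMap.BilinForm.sum_left]
        refine Finset.sum_congr rfl fun a _ => ?_
        rw [LinearMap.BilinForm.smul_left, LinearMap.BilinForm.sum_right, Finset.mul_sum]
        refine Finset.sum_congr rfl fun c _ => ?_
        rw [LinearMap.BilinForm.smul_right]
        ring
    _ = (Mᵀ * LinearMap.BilinForm.toMatrix b B * M) i j := by
        rw [Matrix.mul_apply]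
        simp_rw [Matrix.mul_apply, Matrix.transpose_apply, LinearMap.BilinForm.toMatrix_apply, Finset.sum_mul]
        conv_lhs => rw [Finset.sum_comm]
        refine Finset.sum_congr rfl fun c _ => Finset.sum_congr rfl fun a _ => ?_
        ring

/-- The basis expansion `u bᵢ = ∑ₐ (M_u)_{a i} bₐ` of a linear map by its matrix. [folklore] -/
private theorem apply_basis_eq_sum_toMatrix (b : Module.Basis (Fin n) ℂ V) (u : V →ₗ[ℂ] V) (i : Fin n) :
    u (b i) = ∑ a, LinearMap.toMatrix b b u a i • b a := by
  simp_rw [LinearMap.toMatrix_apply]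
  exact (b.sum_repr (u (b i))).symm

/-- **A form-preserving map has `Mᵀ Ω M = Ω`** (`M` its matrix, `Ω` the Gram matrix).
[cite: Milne1999LefschetzClasses, §1 p. 644] [cite: LangeBirkenhake1992, Lemma 1.1.17] -/
theorem toMatrix_transpose_mul_mul_eq (B : LinearMap.BilinForm ℂ V) (b : Module.Basis (Fin n) ℂ V)
    {u : V →ₗ[ℂ] V} (hB : ∀ x y, B (u x) (u y) = B x y) :
    (LinearMap.toMatrix b b u)ᵀ * LinearMap.BilinForm.toMatrix b B * LinearMap.toMatrix b b u =
      LinearMap.BilinForm.toMatrix b B := by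
  ext i j
  rw [← bilin_apply_eq_transpose_mul_mul B b (u := ⇑u) (apply_basis_eq_sum_toMatrix b u) i j, hB,
    LinearMap.BilinForm.toMatrix_apply]

/-- **`Mᵀ Ω M = Ω` implies `M Ω⁻¹ Mᵀ = Ω⁻¹`** (`Ω` invertible): the dual form `φ ∈ H ⊗ H` (Milne p. 654: "`φ`
can be identified with an element of `H ⊗ H`") is invariant. [cite: Milne1999LefschetzClasses, §3 p. 654] -/
theorem mul_inv_mul_transpose_eq {Ω M : Matrix (Fin n) (Fin n) ℂ} (hΩ : IsUnit Ω.det) (h : Mᵀ * Ω * M = Ω) :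
    M * Ω⁻¹ * Mᵀ = Ω⁻¹ := by
  have h1 : Ω⁻¹ * Mᵀ * Ω * M = 1 := by
    rw [Matrix.mul_assoc Ω⁻¹, Matrix.mul_assoc Ω⁻¹, h, Matrix.nonsing_inv_mul Ω hΩ]
  have h2 : M * (Ω⁻¹ * Mᵀ * Ω) = 1 := mul_eq_one_comm.1 h1
  symm
  refine Matrix.inv_eq_left_inv ?_
  calc M * Ω⁻¹ * Mᵀ * Ω = M * (Ω⁻¹ * Mᵀ * Ω) := by simp only [Matrix.mul_assoc]
    _ = 1 := h2

/-- Re-expansion of a weighted sum of values of a bilinear map in the LEFT argument along `x_a = ∑_{a'} M_{a'a} b_{a'}`.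
[folklore] -/
private theorem sum_smul_bilin_left (Φ : V →ₗ[ℂ] V →ₗ[ℂ] W) (b : Fin n → V) (M : Matrix (Fin n) (Fin n) ℂ)
    (θ : Fin n → ℂ) (y : V) :
    ∑ a, θ a • Φ (∑ a', M a' a • b a') y = ∑ a', (∑ a, M a' a * θ a) • Φ (b a') y := by
  simp_rw [map_sum, map_smul, LinearMap.sum_apply, LinearMap.smul_apply, Finset.smul_sum, smul_smul,
    Finset.sum_smul]
  rw [Finset.sum_comm]
  refine Finset.sum_congr rfl fun a' _ => Finset.sum_congr rfl fun a _ => ?_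
  rw [mul_comm]

/-- Re-expansion in the RIGHT argument along `y_c = ∑_{c'} M_{c'c} b_{c'}`. [folklore] -/
private theorem sum_smul_bilin_right (Φ : V →ₗ[ℂ] V →ₗ[ℂ] W) (b : Fin n → V) (M : Matrix (Fin n) (Fin n) ℂ)
    (θ : Fin n → ℂ) (x : V) :
    ∑ c, θ c • Φ x (∑ c', M c' c • b c') = ∑ c', (∑ c, M c' c * θ c) • Φ x (b c') := by
  simp_rw [map_sum, map_smul, Finset.smul_sum, smul_smul, Finset.sum_smul]
  rw [Finset.sum_comm]
  refine Finset.sum_congr rfl fun c' _ => Finset.sum_congr rfl fun c _ => ?_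
  rw [mul_comm]

/-- **Change of variables in a `2`-tensor**: `∑_{a,c} Θ_{ac} Φ(u bₐ, u b_c) = ∑_{a',c'} (M Θ Mᵀ)_{a'c'} Φ(b_{a'}, b_{c'})`
for `u bₐ = ∑_{a'} M_{a'a} b_{a'}` (Goodman–Wallach (5.34): `Θ(γᵗ x γ) = ρ₂^*(g)⁻¹ Θ(x)`).
[cite: GoodmanWallachGTM255, Thm. 5.3.3 (proof, (5.34))] -/
theorem sum_sum_smul_bilin_eq (Φ : V →ₗ[ℂ] V →ₗ[ℂ] W) (b : Fin n → V) {u : V → V}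
    {M : Matrix (Fin n) (Fin n) ℂ} (hu : ∀ i, u (b i) = ∑ a, M a i • b a) (Θ : Matrix (Fin n) (Fin n) ℂ) :
    ∑ a, ∑ c, Θ a c • Φ (u (b a)) (u (b c)) = ∑ a', ∑ c', (M * Θ * Mᵀ) a' c' • Φ (b a') (b c') := by
  have step1 : ∀ a, ∑ c, Θ a c • Φ (u (b a)) (u (b c)) = ∑ c', (Θ * Mᵀ) a c' • Φ (u (b a)) (b c') := by
    intro a
    simp_rw [hu]
    rw [sum_smul_bilin_right Φ b M (fun c => Θ a c)]
    refine Finset.sum_congr rfl fun c' _ => ?_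
    congr 1
    rw [Matrix.mul_apply]
    refine Finset.sum_congr rfl fun c _ => ?_
    rw [Matrix.transpose_apply, mul_comm]
  simp_rw [step1]
  rw [Finset.sum_comm]
  conv_rhs => rw [Finset.sum_comm]
  refine Finset.sum_congr rfl fun c' _ => ?_
  simp_rw [hu]
  rw [sum_smul_bilin_left Φ b M (fun a => (Θ * Mᵀ) a c') (b c')]
  refine Finset.sum_congr rfl fun a' _ => ?_
  rw [Matrix.mul_assoc, Matrix.mul_apply]

end Matrices

/-! ### §2 Crossed classes of a weighted divisor class are divisor classes -/

section Cross

variable {A : AbelianVariety ℂ} {n : ℕ}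

/-- **Crossed classes of a divisor class are divisor classes, weighted form**: for homomorphisms
`g, g' : T → A`, degree-one classes `e_a` of `A` and an antisymmetric matrix `Θ` with
`θ = ∑_{a,c} Θ_{ac} e_a ⌣ e_c ∈ B¹(A) ⊗ ℂ`, the class `∑_{a,c} Θ_{ac} g^*e_a ⌣ g'^*e_c =
½((g + g')^*θ − g^*θ − g'^*θ)` lies in `B¹(T) ⊗ ℂ` (pull-back is additive on `H¹` and multiplicative; the
two mixed terms agree by graded commutativity and the antisymmetry of `Θ`). These are Milne's degree-`2`
invariants of `A^r` pairing two copies, `φ ∈ H ⊗ H` placed on two slots (Prop. 3.3 for `A × A`).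
[cite: Milne1999LefschetzClasses, Prop. 3.3 and §3 p. 654] [cite: HatcherAT2002, §3.2 Prop. 3.10] -/
theorem sum_smul_cross_mem_span_rational_oneOne {T : AbelianVariety ℂ} (g g' : T ⟶ A)
    (e : Fin n → complexBetti A.X 1) (Θ : Matrix (Fin n) (Fin n) ℂ) (hΘ : ∀ a c, Θ c a = -Θ a c)
    (hθ : (∑ a, ∑ c, Θ a c • cupProduct (rfl : 1 + 1 = 2) (e a) (e c)) ∈
      Submodule.span ℂ {c : complexBetti A.X 2 | IsRationalClass c ∧ IsOfHodgeType A.dim A.X 2 1 1 c}) :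
    (∑ a, ∑ c, Θ a c • cupProduct (rfl : 1 + 1 = 2) (complexBetti.map g.hom.hom.hom 1 (e a))
        (complexBetti.map g'.hom.hom.hom 1 (e c))) ∈
      Submodule.span ℂ {c : complexBetti T.X 2 | IsRationalClass c ∧ IsOfHodgeType T.dim T.X 2 1 1 c} := by
  have hT : IsSmoothProjective T.dim T.X := AbelianVariety.isSmoothProjective_holds
  have hAs : IsSmoothProjective A.dim A.X := AbelianVariety.isSmoothProjective_holds
  set θ : complexBetti A.X 2 := ∑ a, ∑ c, Θ a c • cupProduct (rfl : 1 + 1 = 2) (e a) (e c) with hθdef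
  -- the mixed term
  set X : complexBetti T.X 2 := ∑ a, ∑ c, Θ a c • cupProduct (rfl : 1 + 1 = 2)
    (complexBetti.map g.hom.hom.hom 1 (e a)) (complexBetti.map g'.hom.hom.hom 1 (e c)) with hXdef
  have hpull : ∀ ψ : T ⟶ A, complexBetti.map ψ.hom.hom.hom 2 θ =
      ∑ a, ∑ c, Θ a c • cupProduct (rfl : 1 + 1 = 2) (complexBetti.map ψ.hom.hom.hom 1 (e a))
        (complexBetti.map ψ.hom.hom.hom 1 (e c)) := by
    intro ψ
    rw [hθdef, map_sum]
    refine Finset.sum_congr rfl fun a _ => ?_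
    rw [map_sum]
    refine Finset.sum_congr rfl fun c _ => ?_
    rw [map_smul, complexBetti.map_cupProduct]
  -- the other mixed term equals `X`
  have hX' : ∑ a, ∑ c, Θ a c • cupProduct (rfl : 1 + 1 = 2) (complexBetti.map g'.hom.hom.hom 1 (e a))
      (complexBetti.map g.hom.hom.hom 1 (e c)) = X := by
    have hswap : ∀ x y : complexBetti T.X 1,
        cupProduct (rfl : 1 + 1 = 2) x y = -cupProduct (rfl : 1 + 1 = 2) y x := by
      intro x y
      rw [cupProduct_gradedComm_holds ℂ (ComplexPoints T.X) (rfl : 1 + 1 = 2) rfl x y]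
      simp
    rw [hXdef, Finset.sum_comm]
    refine Finset.sum_congr rfl fun c _ => Finset.sum_congr rfl fun a _ => ?_
    rw [hswap, hΘ a c, smul_neg, neg_smul]
  have key : (2 : ℂ) • X = complexBetti.map (g + g').hom.hom.hom 2 θ - complexBetti.map g.hom.hom.hom 2 θ -
      complexBetti.map g'.hom.hom.hom 2 θ := by
    have hadd : ∀ v : complexBetti A.X 1, complexBetti.map (g + g').hom.hom.hom 1 v =
        complexBetti.map g.hom.hom.hom 1 v + complexBetti.map g'.hom.hom.hom 1 v :=
      fun v => complexBetti_map_add_deg_one g g' v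
    have hsum : complexBetti.map (g + g').hom.hom.hom 2 θ = complexBetti.map g.hom.hom.hom 2 θ + X +
        (∑ a, ∑ c, Θ a c • cupProduct (rfl : 1 + 1 = 2) (complexBetti.map g'.hom.hom.hom 1 (e a))
          (complexBetti.map g.hom.hom.hom 1 (e c))) + complexBetti.map g'.hom.hom.hom 2 θ := by
      rw [hpull, hpull, hpull, hXdef]
      simp only [hadd, map_add, LinearMap.add_apply, smul_add, Finset.sum_add_distrib]
      abel
    rw [hsum, hX', two_smul]
    abel
  have hmem : (2 : ℂ) • X ∈
      Submodule.span ℂ {c : complexBetti T.X 2 | IsRationalClass c ∧ IsOfHodgeType T.dim T.X 2 1 1 c} := by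
    rw [key]
    exact Submodule.sub_mem _ (Submodule.sub_mem _ (map_mem_span_rational_oneOne hT hAs _ hθ)
      (map_mem_span_rational_oneOne hT hAs _ hθ)) (map_mem_span_rational_oneOne hT hAs _ hθ)
  have h2 : X = (2 : ℂ)⁻¹ • ((2 : ℂ) • X) := by
    rw [smul_smul, inv_mul_cancel₀ (two_ne_zero), one_smul]
  rw [h2]
  exact Submodule.smul_mem _ _ hmem

end Cross

/-! ### §3 Powers of an abelian variety with `C(A) ⊗ ℂ = End(H¹)`: Prop. 3.6 (a) with multiplicity -/

section Main

variable {A : AbelianVariety ℂ}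

/-- **Milne 1999, Prop. 3.6 (a) with Prop. 3.4 and p. 656, for the POWERS `A^{N+1}` of a complex abelian
variety with `C(A) ⊗ ℂ = End(H¹(A))`** (every endomorphism acts on `H¹(A(ℂ); ℂ)` by a scalar, e.g.
`End(A) = ℤ`; then `S(A)(ℂ) = Sp(H¹(A), Q_h)` is ONE symplectic block of rank `2 dim A`, and
`S(A^{N+1}) = S(A)` acts on `H¹(A^{N+1}) = (N+1) H¹(A)` diagonally — multiplicity `r = N + 1`), `S(ℂ)`-form
on the carriers: every class of `H^{2p}(A^{N+1}(ℂ); ℂ)` fixed by `⋀^{2p}u` for all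
`u ∈ S(A^{N+1})(ℂ) = unitaryCentralizerGroup (A.powSucc N) (Σᵢ prᵢ^* h)` lies in `Dᵖ(A^{N+1}) ⊗ ℂ`
("`(⋀^*(rH))^G = k[(⊗² rH)^G]` all `r ≥ 1`, (a) `G = Sp(φ)`"). Proof: the one-block criterion
`mem_divisorClassesSpan_of_forall_exteriorPullback_eq_of_spBlock` (the tensor FFT for `Sp`) on the letters
`prⱼ^* bₗ` for a basis `b` of `H¹(A)`; the diagonal images `u^{⊕(N+1)}` (`LefschetzCentraliserPowers.diagPow`)
of the automorphisms `u` of `H¹(A)` preserving `Q_h` — all of which lie in `S(A)(ℂ)`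
(`mem_unitaryCentralizerGroup_iff_of_centralizerAlgebra_eq_top`); and the crossed classes
`∑ (Ω⁻¹)_{ac} prⱼ^* bₐ ⌣ pr_{j'}^* b_c` are divisor classes because `θ = ∑ (Ω⁻¹)_{ac} bₐ ⌣ b_c ∈ B¹(A) ⊗ ℂ`: it is
fixed by every `u ∈ S(A)(ℂ)` (`M Ω⁻¹ Mᵀ = Ω⁻¹`) and the `S(A)(ℂ)`-invariants of `H²` are Hodge classes
(Prop. 3.3, `S(ℂ)`-form `mem_hodgeClassSpan_of_forall_exteriorPullback_eq`).
[cite: Milne1999LefschetzClasses, §1 pp. 643–644, Props. 3.3–3.4, 3.6 (a), p. 656, Cor. 4.5 (p. 659)]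
[cite: GoodmanWallachGTM255, Thm. 5.3.3 (2) and Thm. 5.3.5] -/
theorem mem_divisorClassesSpan_powSucc_of_forall_exteriorPullback_eq_of_centralizerAlgebra_eq_top
    (hC : centralizerAlgebra A = ⊤) {h : complexBetti A.X 2} (hQ : IsRationalClass h)
    (hK : ∃ s : ℝ, 0 < s ∧ IsKaehlerClass A.dim A.X ((s : ℂ) • h))
    (N p : ℕ) (x : complexBetti (A.powSucc N).X (2 * p))
    (hx : ∀ u ∈ unitaryCentralizerGroup (A.powSucc N) (powPolarizationClass A h N),
      exteriorPullback (AbelianVariety.hasExteriorCohomologyH1_complexPoints (A.powSucc N))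
        (u : complexBetti (A.powSucc N).X 1 →ₗ[ℂ] complexBetti (A.powSucc N).X 1) (2 * p) x = x) :
    x ∈ divisorClassesSpan (A.powSucc N).X (A.powSucc N).dim p := by
  classical
  haveI : Module.Finite ℂ (complexBetti A.X 1) := abelianVarietyCohomologyExteriorH1_holds.finite_one A
  haveI : Module.Finite ℂ (complexBetti (A.powSucc N).X 1) :=
    abelianVarietyCohomologyExteriorH1_holds.finite_one (A.powSucc N)
  have hX := AbelianVariety.hasExteriorCohomologyH1_complexPoints (A.powSucc N)
  have hXA := AbelianVariety.hasExteriorCohomologyH1_complexPoints A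
  -- degree `0`: everything is a multiple of the unit class
  rcases Nat.eq_zero_or_pos p with rfl | hp1
  · have htop : Submodule.span ℂ (Set.range (cupPowOne ℂ (ComplexPoints (A.powSucc N).X) 0)) = ⊤ :=
      hX.span_range_cupPowOne 0
    have hrange : Set.range (cupPowOne ℂ (ComplexPoints (A.powSucc N).X) 0) =
        {singularCohomology.one ℂ (ComplexPoints (A.powSucc N).X)} := by
      ext c
      simp only [Set.mem_range, cupPowOne_zero, Set.mem_singleton_iff]
      exact ⟨fun ⟨_, e⟩ => e.symm, fun e => ⟨fun i => Fin.elim0 i, e.symm⟩⟩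
    have hx' : x ∈ Submodule.span ℂ (Set.range (cupPowOne ℂ (ComplexPoints (A.powSucc N).X) 0)) := by
      rw [htop]; exact Submodule.mem_top
    rw [hrange] at hx'
    refine Submodule.span_mono (fun c hc => ?_) hx'
    rw [Set.mem_singleton_iff] at hc
    exact mem_divisorMonomials_zero.2 hc
  -- dimension `0`: no classes in positive degree
  rcases Nat.eq_zero_or_pos A.dim with hA | hA0
  · haveI : Subsingleton (complexBetti (A.powSucc N).X (2 * p)) :=
      hX.subsingleton_of_lt (by rw [AbelianVariety.finrank_complexBetti_one, dim_powSucc_eq_succ_mul, hA]; omega)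
    rw [Subsingleton.elim x 0]
    exact Submodule.zero_mem _
  -- the polarization data of `A`: the scalar symplectic form `Bf = λ ∘ Q_h`
  obtain ⟨s, hs, hKs⟩ := hK
  have hnd := eq_zero_of_forall_polarizationPairingOne_eq_zero_of_isKaehlerClass_smul' hs.ne' hKs
  have hh : h ∈ hodgeClassSpan A.dim A.X 1 := mem_hodgeClassSpan_one_of_isKaehlerClass_smul hQ hs.ne' hKs
  obtain ⟨Bf, hBalt, hBnd, lam, hlam, hBapp⟩ := exists_bilinForm_isAlt_nondegenerate (A := A) hnd
  -- membership in `S(A)(ℂ) = Sp(H¹, Q_h)`: preserve `Bf`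
  have hmem : ∀ u : complexBetti A.X 1 ≃ₗ[ℂ] complexBetti A.X 1,
      (∀ a c, Bf (u a) (u c) = Bf a c) → u ∈ unitaryCentralizerGroup A h := fun u hu =>
    (mem_unitaryCentralizerGroup_iff_of_centralizerAlgebra_eq_top hC).2 fun a c =>
      hlam (by rw [← hBapp, ← hBapp, hu a c])
  have hofmem : ∀ u ∈ unitaryCentralizerGroup A h, ∀ a c, Bf (u a) (u c) = Bf a c := fun u hu a c => by
    rw [hBapp, hBapp, (mem_unitaryCentralizerGroup_iff_of_centralizerAlgebra_eq_top hC).1 hu]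
  -- a basis of `H¹(A)` and the Gram matrix `Ω` of `Bf`
  set n₁ := Module.finrank ℂ (complexBetti A.X 1) with hn₁
  let b₁ : Module.Basis (Fin n₁) ℂ (complexBetti A.X 1) := Module.finBasis ℂ (complexBetti A.X 1)
  set Ω : Matrix (Fin n₁) (Fin n₁) ℂ := LinearMap.BilinForm.toMatrix b₁ Bf with hΩdef
  have hΩapply : ∀ a c, Ω a c = Bf (b₁ a) (b₁ c) := fun a c => LinearMap.BilinForm.toMatrix_apply _ _ _ _
  have hΩdet : Ω.det ≠ 0 := (LinearMap.BilinForm.nondegenerate_iff_det_ne_zero b₁).1 hBnd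
  have hΩunit : IsUnit Ω.det := isUnit_iff_ne_zero.2 hΩdet
  have hΩa : (Matrix.toBilin' Ω).IsAlt :=
    isAlt_toBilin'_of_forall_eq_neg fun a c => by rw [hΩapply, hΩapply, ← hBalt.neg_eq]
  have hΩn : (Matrix.toBilin' Ω).Nondegenerate :=
    LinearMap.BilinForm.nondegenerate_toBilin'_iff_det_ne_zero.2 hΩdet
  -- the letters of `H¹(A^{N+1})`: `prⱼ^* b_ℓ`
  let y : Fin (N + 1) × Fin n₁ → complexBetti (A.powSucc N).X 1 := fun sl =>
    complexBetti.map (powSlots A N sl.1).hom.hom.hom 1 (b₁ sl.2)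
  have hy : ∀ j ℓ, y (j, ℓ) = complexBetti.map (powSlots A N j).hom.hom.hom 1 (b₁ ℓ) := fun _ _ => rfl
  have hyspan : ⊤ ≤ Submodule.span ℂ (Set.range y) := by
    intro z _
    have hz := mem_span_map_powSlots A N z
    refine (Submodule.span_le.2 ?_) hz
    rintro _ ⟨⟨j, v⟩, rfl⟩
    change complexBetti.map (powSlots A N j).hom.hom.hom 1 v ∈ Submodule.span ℂ (Set.range y)
    rw [← b₁.sum_repr v, map_sum]
    refine Submodule.sum_mem _ fun a _ => ?_
    rw [map_smul]
    exact Submodule.smul_mem _ _ (Submodule.subset_span ⟨(j, a), rfl⟩)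
  have hcard : Fintype.card (Fin (N + 1) × Fin n₁) = Module.finrank ℂ (complexBetti (A.powSucc N).X 1) := by
    rw [AbelianVariety.finrank_complexBetti_one, dim_powSucc_eq_succ_mul, Fintype.card_prod, Fintype.card_fin,
      Fintype.card_fin, hn₁, AbelianVariety.finrank_complexBetti_one]
    ring
  obtain ⟨bB, hbB⟩ : ∃ bB : Module.Basis (Fin (N + 1) × Fin n₁) ℂ (complexBetti (A.powSucc N).X 1),
      ∀ sl, bB sl = y sl :=
    ⟨basisOfTopLeSpanOfCardEqFinrank y hyspan hcard, fun sl => by rw [coe_basisOfTopLeSpanOfCardEqFinrank]⟩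
  -- THE CRITERION: one symplectic block acting diagonally on the slots
  refine mem_divisorClassesSpan_of_forall_exteriorPullback_eq_of_spBlock bB Ω hΩa hΩn
    (unitaryCentralizerGroup (A.powSucc N) (powPolarizationClass A h N))
    (fun g hg => ?_) (fun s s' => ?_) p x hx
  · -- the diagonal image of the automorphism of `H¹(A)` with matrix `g`
    have hgdet : IsUnit g.det := by
      have hdet := congrArg Matrix.det hg
      rw [Matrix.det_mul, Matrix.det_mul, Matrix.det_transpose] at hdet
      have hsq : g.det * g.det = 1 := by
        have h1 : g.det * g.det * Ω.det = 1 * Ω.det := by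
          rw [one_mul]
          calc g.det * g.det * Ω.det = g.det * Ω.det * g.det := by ring
            _ = Ω.det := hdet
        exact mul_right_cancel₀ hΩdet h1
      exact IsUnit.of_mul_eq_one _ hsq
    let f : complexBetti A.X 1 →ₗ[ℂ] complexBetti A.X 1 := Matrix.toLin b₁ b₁ g
    have hfdet : IsUnit (LinearMap.toMatrix b₁ b₁ f).det := by
      change IsUnit (LinearMap.toMatrix b₁ b₁ (Matrix.toLin b₁ b₁ g)).det
      rw [LinearMap.toMatrix_toLin]
      exact hgdet
    let u₁ : complexBetti A.X 1 ≃ₗ[ℂ] complexBetti A.X 1 := LinearEquiv.ofIsUnitDet hfdet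
    have hu₁ : ∀ i, u₁ (b₁ i) = ∑ a, g a i • b₁ a := fun i => by
      change f (b₁ i) = _
      exact Matrix.toLin_self b₁ b₁ g i
    have hu₁B : ∀ a c, Bf (u₁ a) (u₁ c) = Bf a c := by
      have H : Bf.comp (u₁ : complexBetti A.X 1 →ₗ[ℂ] complexBetti A.X 1)
          (u₁ : complexBetti A.X 1 →ₗ[ℂ] complexBetti A.X 1) = Bf := by
        refine LinearMap.BilinForm.ext_basis b₁ fun i j => ?_
        rw [LinearMap.BilinForm.comp_apply, LinearEquiv.coe_coe,
          bilin_apply_eq_transpose_mul_mul Bf b₁ (u := ⇑u₁) (M := g) hu₁ i j, ← hΩdef, hg, hΩapply]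
      intro a c
      have e := congrArg (fun B' : LinearMap.BilinForm ℂ (complexBetti A.X 1) => B' a c) H
      simp only [LinearMap.BilinForm.comp_apply, LinearEquiv.coe_coe] at e
      exact e
    have hu₁S : u₁ ∈ unitaryCentralizerGroup A h := hmem u₁ hu₁B
    refine ⟨diagPow A u₁ N, diagPow_mem_unitaryCentralizerGroup hA0 hu₁S N, fun j ℓ => ?_⟩
    rw [hbB, hy, diagPow_intertwine_right hu₁S.1, hu₁, map_sum]
    refine Finset.sum_congr rfl fun ℓ' _ => ?_
    rw [map_smul, hbB, hy]
  · -- the crossed classes `∑ (Ω⁻¹)_{ac} pr_s^* b_a ⌣ pr_{s'}^* b_c` are divisor classes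
    simp_rw [hbB]
    change (∑ a, ∑ c, Ω⁻¹ a c • cupProduct (rfl : 1 + 1 = 2)
      (complexBetti.map (powSlots A N s).hom.hom.hom 1 (b₁ a))
      (complexBetti.map (powSlots A N s').hom.hom.hom 1 (b₁ c))) ∈ _
    -- `Ω⁻¹` is antisymmetric
    have hΩt : Ωᵀ = -Ω := Matrix.ext fun a c => by
      rw [Matrix.transpose_apply, Matrix.neg_apply]
      exact apply_eq_neg_of_isAlt hΩa a c
    have hΩit : Ω⁻¹ᵀ = -Ω⁻¹ := by
      rw [Matrix.transpose_nonsing_inv, hΩt]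
      exact Matrix.inv_eq_left_inv (by rw [neg_mul_neg, Matrix.nonsing_inv_mul Ω hΩunit])
    have hΘ : ∀ a c, Ω⁻¹ c a = -Ω⁻¹ a c := fun a c => by
      have e := congr_fun (congr_fun hΩit a) c
      rwa [Matrix.transpose_apply, Matrix.neg_apply] at e
    refine sum_smul_cross_mem_span_rational_oneOne (powSlots A N s) (powSlots A N s') (⇑b₁) Ω⁻¹ hΘ ?_
    -- `θ = ∑ (Ω⁻¹)_{ac} b_a ⌣ b_c ∈ B¹(A) ⊗ ℂ`: it is fixed by every `u ∈ S(A)(ℂ)` (Prop. 3.3, `S(ℂ)`-form)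
    refine mem_hodgeClassSpan_of_forall_exteriorPullback_eq hh (p := 1) fun u hu => ?_
    have huB := hofmem u hu
    set M := LinearMap.toMatrix b₁ b₁ (u : complexBetti A.X 1 →ₗ[ℂ] complexBetti A.X 1) with hMdef
    have huM : ∀ i, (u : complexBetti A.X 1 →ₗ[ℂ] complexBetti A.X 1) (b₁ i) = ∑ a, M a i • b₁ a :=
      apply_basis_eq_sum_toMatrix b₁ _
    have hMΩ : Mᵀ * Ω * M = Ω := toMatrix_transpose_mul_mul_eq Bf b₁ huB
    have hinv : M * Ω⁻¹ * Mᵀ = Ω⁻¹ := mul_inv_mul_transpose_eq hΩunit hMΩ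
    change exteriorPullback hXA (u : complexBetti A.X 1 →ₗ[ℂ] complexBetti A.X 1) 2
      (∑ a, ∑ c, Ω⁻¹ a c • cupProduct (rfl : 1 + 1 = 2) (b₁ a) (b₁ c)) = _
    rw [map_sum]
    simp_rw [map_sum, map_smul, exteriorPullback_cupProduct_one_one]
    have key := sum_sum_smul_bilin_eq (cupProduct (rfl : 1 + 1 = 2)) (⇑b₁)
      (u := ⇑(u : complexBetti A.X 1 →ₗ[ℂ] complexBetti A.X 1)) huM Ω⁻¹
    rw [key, hinv]

/-- **The polarization package of every power `A^{N+1}` of an abelian variety with `C(A) ⊗ ℂ = End(H¹)`**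
(`0 < dim A`): Milne's class `Σᵢ prᵢ^* h ∈ B¹(A^{N+1}) ⊗ ℂ` with `(Σᵢ prᵢ^* h)^{dim} ≠ 0`, `Q` non-degenerate,
and the `S(ℂ)`-form above — the datum consumed by `SpecialLefschetzGroupInvariantsFiniteProducts`.
[cite: Milne1999LefschetzClasses, §1 p. 643, Prop. 3.4, Cor. 4.5 (p. 659)] -/
theorem exists_polarization_invariants_le_powSucc_of_centralizerAlgebra_eq_top (hC : centralizerAlgebra A = ⊤)
    {h : complexBetti A.X 2} (hQ : IsRationalClass h)
    (hK : ∃ s : ℝ, 0 < s ∧ IsKaehlerClass A.dim A.X ((s : ℂ) • h)) (hA0 : 0 < A.dim) (N : ℕ) :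
    ∃ D : complexBetti (A.powSucc N).X 2, D ∈ hodgeClassSpan (A.powSucc N).dim (A.powSucc N).X 1 ∧
      lefschetzPow D ((A.powSucc N).dim - 1) 2 D ≠ 0 ∧
      (∀ z : complexBetti (A.powSucc N).X 1,
        (∀ y, polarizationPairingOne (A.powSucc N).X D ((A.powSucc N).dim - 1) z y = 0) → z = 0) ∧
      ∀ (a : ℕ) (y : complexBetti (A.powSucc N).X (2 * a)), (∀ u ∈ unitaryCentralizerGroup (A.powSucc N) D,
        exteriorPullback (AbelianVariety.hasExteriorCohomologyH1_complexPoints (A.powSucc N))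
          (u : complexBetti (A.powSucc N).X 1 →ₗ[ℂ] complexBetti (A.powSucc N).X 1) (2 * a) y = y) →
        y ∈ divisorClassesSpan (A.powSucc N).X (A.powSucc N).dim a := by
  obtain ⟨s, hs, hKs⟩ := hK
  have hnd := eq_zero_of_forall_polarizationPairingOne_eq_zero_of_isKaehlerClass_smul' hs.ne' hKs
  have hh : h ∈ hodgeClassSpan A.dim A.X 1 := mem_hodgeClassSpan_one_of_isKaehlerClass_smul hQ hs.ne' hKs
  have htop : lefschetzPow h (A.dim - 1) 2 h ≠ 0 := lefschetzPow_self_ne_zero_of_isKaehlerClass_smul hA0 hKs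
  exact ⟨powPolarizationClass A h N, powPolarizationClass_mem_hodgeClassSpan hh N,
    lefschetzPow_powPolarizationClass_self_ne_zero hA0 htop N,
    eq_zero_of_forall_polarizationPairingOne_powPolarizationClass_eq_zero hA0 htop hnd N,
    fun a y hy => mem_divisorClassesSpan_powSucc_of_forall_exteriorPullback_eq_of_centralizerAlgebra_eq_top hC hQ
      ⟨s, hs, hKs⟩ N a y hy⟩

/-- **The conclusion of the record `Milne1999_specialLefschetzGroup_invariants_le` (Milne 1999, Cor. 4.5 with
Thm. 4.4, Thm. 3.2 and Prop. 3.6 (a) WITH MULTIPLICITY) PROVED for every power of a complex abelian variety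
with `C(A) ⊗ ℂ = End(H¹(A))`** (e.g. `End(A) = ℤ`): for every `N`, every class `x ∈ H^{2p}(A^{N+1}(ℂ); ℂ)`
fixed by every element of `specialLefschetzGroup (dim A^{N+1}) (A^{N+1}).X` lies in `Dᵖ_hom(A^{N+1})_ℂ`
(`A^{N+1} = A.powSucc N`; the polarization class is the rational Kähler class of a projective embedding).
[cite: Milne1999LefschetzClasses, Cor. 4.5 and Cor. 4.7 (p. 659), Thm. 3.2, Prop. 3.6 (a), p. 656]
[cite: GoodmanWallachGTM255, Thm. 5.3.3 (2)] -/
theorem specialLefschetzGroup_invariants_le_powSucc_of_centralizerAlgebra_eq_top (hC : centralizerAlgebra A = ⊤)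
    (N p : ℕ) (x : complexBetti (A.powSucc N).X (2 * p))
    (hx : ∀ g ∈ specialLefschetzGroup (A.powSucc N).dim (A.powSucc N).X, g (2 * p) x = x) :
    x ∈ divisorClassesSpan (A.powSucc N).X (A.powSucc N).dim p := by
  classical
  have hX := AbelianVariety.hasExteriorCohomologyH1_complexPoints (A.powSucc N)
  rcases Nat.eq_zero_or_pos A.dim with hA | hA0
  · -- dimension `0`: `H^{2p}(A^{N+1}) = 0` for `p ≥ 1`, `H⁰ = ℂ · 1`
    rcases Nat.eq_zero_or_pos p with rfl | hp1
    · have htop : Submodule.span ℂ (Set.range (cupPowOne ℂ (ComplexPoints (A.powSucc N).X) 0)) = ⊤ :=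
        hX.span_range_cupPowOne 0
      have hrange : Set.range (cupPowOne ℂ (ComplexPoints (A.powSucc N).X) 0) =
          {singularCohomology.one ℂ (ComplexPoints (A.powSucc N).X)} := by
        ext c
        simp only [Set.mem_range, cupPowOne_zero, Set.mem_singleton_iff]
        exact ⟨fun ⟨_, e⟩ => e.symm, fun e => ⟨fun i => Fin.elim0 i, e.symm⟩⟩
      have hx' : x ∈ Submodule.span ℂ (Set.range (cupPowOne ℂ (ComplexPoints (A.powSucc N).X) 0)) := by
        rw [htop]; exact Submodule.mem_top
      rw [hrange] at hx'
      refine Submodule.span_mono (fun c hc => ?_) hx'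
      rw [Set.mem_singleton_iff] at hc
      exact mem_divisorMonomials_zero.2 hc
    · haveI : Module.Finite ℂ (complexBetti (A.powSucc N).X 1) :=
        abelianVarietyCohomologyExteriorH1_holds.finite_one (A.powSucc N)
      haveI : Subsingleton (complexBetti (A.powSucc N).X (2 * p)) :=
        hX.subsingleton_of_lt (by rw [AbelianVariety.finrank_complexBetti_one, dim_powSucc_eq_succ_mul, hA]; omega)
      rw [Subsingleton.elim x 0]
      exact Submodule.zero_mem _
  · -- the rational Kähler class of a projective embedding
    obtain ⟨D⟩ := nonempty_kaehlerRationalDatum (AbelianVariety.isSmoothProjective_holds (A := A))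
    have hQ : IsRationalClass D.Hη := D.isRationalClass_Hη
    have hK1 : IsKaehlerClass A.dim A.X (((1 : ℝ) : ℂ) • D.Hη) := by
      rw [Complex.ofReal_one, one_smul]
      exact D.isKaehlerClassVia.isKaehlerClass D.isNatural D.isMultiplicative
    exact specialLefschetzGroup_invariants_le_of_exists_polarization_invariants_le (dim_powSucc_pos hA0 N)
      (exists_polarization_invariants_le_powSucc_of_centralizerAlgebra_eq_top hC hQ ⟨1, one_pos, hK1⟩ hA0 N) p x hx

/-- **The same with the hypothesis "every `φ^*` is a scalar on `H¹(A(ℂ); ℂ)`"** (e.g. `End(A) = ℤ`), for all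
powers. [cite: Milne1999LefschetzClasses, Cor. 4.5, Thm. 3.2, Prop. 3.6 (a) and §1 p. 644] -/
theorem specialLefschetzGroup_invariants_le_powSucc_of_forall_pullbackOne_eq_algebraMap
    (hC : ∀ φ : A ⟶ A, ∃ z : ℂ, pullbackOne A φ = algebraMap ℂ (Module.End ℂ (complexBetti A.X 1)) z)
    (N p : ℕ) (x : complexBetti (A.powSucc N).X (2 * p))
    (hx : ∀ g ∈ specialLefschetzGroup (A.powSucc N).dim (A.powSucc N).X, g (2 * p) x = x) :
    x ∈ divisorClassesSpan (A.powSucc N).X (A.powSucc N).dim p :=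
  specialLefschetzGroup_invariants_le_powSucc_of_centralizerAlgebra_eq_top (centralizerAlgebra_eq_top_iff.2 hC)
    N p x hx

/-- **The record for every complex abelian variety ISOGENOUS to a power of an abelian variety with
`C(A) ⊗ ℂ = End(H¹)`** ("`S(A)` depends only on the isogeny class of `A`", §1 p. 644; Cor. 4.7).
[cite: Milne1999LefschetzClasses, §1 p. 644, Prop. 1.5, Cor. 4.5 and Cor. 4.7 (p. 659)] -/
theorem specialLefschetzGroup_invariants_le_of_isIsogenous_powSucc_of_centralizerAlgebra_eq_top
    {X : AbelianVariety ℂ} (hC : centralizerAlgebra A = ⊤) {h : complexBetti A.X 2} (hQ : IsRationalClass h)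
    (hK : ∃ s : ℝ, 0 < s ∧ IsKaehlerClass A.dim A.X ((s : ℂ) • h)) (hA0 : 0 < A.dim) {N : ℕ}
    (hXA : AbelianVariety.IsIsogenous X (A.powSucc N)) (p : ℕ) (x : complexBetti X.X (2 * p))
    (hx : ∀ g ∈ specialLefschetzGroup X.dim X.X, g (2 * p) x = x) :
    x ∈ divisorClassesSpan X.X X.dim p :=
  specialLefschetzGroup_invariants_le_of_isIsogenous_of_exists hXA (dim_powSucc_pos hA0 N)
    (exists_polarization_invariants_le_powSucc_of_centralizerAlgebra_eq_top hC hQ hK hA0 N) p x hx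

/-- **Cor. 4.5 as an equality of sets on the powers of an abelian variety with `C(A) ⊗ ℂ = End(H¹)`**: the
`S(A^{N+1})`-invariants of `H^{2p}(A^{N+1}(ℂ); ℂ)` are EXACTLY `Dᵖ_hom(A^{N+1})_ℂ` (the converse inclusion is
definitional, `apply_eq_self_of_mem_specialLefschetzGroup`). [cite: Milne1999LefschetzClasses, Cor. 4.5 (p. 659)] -/
theorem setOf_forall_apply_eq_self_eq_divisorClassesSpan_powSucc_of_centralizerAlgebra_eq_top
    (hC : centralizerAlgebra A = ⊤) (N p : ℕ) :
    {x : complexBetti (A.powSucc N).X (2 * p) |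
        ∀ g ∈ specialLefschetzGroup (A.powSucc N).dim (A.powSucc N).X, g (2 * p) x = x} =
      (divisorClassesSpan (A.powSucc N).X (A.powSucc N).dim p : Set _) :=
  Set.Subset.antisymm
    (fun x hx => specialLefschetzGroup_invariants_le_powSucc_of_centralizerAlgebra_eq_top hC N p x hx)
    fun _ hx _ hg => apply_eq_self_of_mem_specialLefschetzGroup hg hx

/-- **Milne Prop. 4.8, (c) ⇒ (a) on every power of an abelian variety with `C(A) ⊗ ℂ = End(H¹)`,
record-free**: if `Hg′(A^{N+1}) = S(A^{N+1})` then `A^{N+1}` supports no exotic Hodge class (van Geemen's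
`B(A^{N+1}) = D(A^{N+1})`). [cite: Milne1999LefschetzClasses, Prop. 4.8 and Cor. 4.5 (pp. 659–660)] -/
theorem isDivisorGenerated_powSucc_of_hodgeGroup_eq_specialLefschetzGroup_of_centralizerAlgebra_eq_top
    (hC : centralizerAlgebra A = ⊤) (N : ℕ)
    (hHg : hodgeGroup (A.powSucc N).dim (A.powSucc N).X =
      specialLefschetzGroup (A.powSucc N).dim (A.powSucc N).X) :
    IsDivisorGenerated (A.powSucc N) :=
  fun p c hc hpp => specialLefschetzGroup_invariants_le_powSucc_of_centralizerAlgebra_eq_top hC N p c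
    fun _ hg => apply_eq_self_of_mem_hodgeGroup (hHg ▸ hg) hc hpp

end Main

end Literature.AlgebraicGeometry.Milne1999
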